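/-
Copyright (c) 2026 the pub-hodgecm-mathlib formalisation cell (harness21).  Prover seat hodgecm-mathlib-K2E3-p06 (g5), Track B «K2-LIT», engine E3, unit U4 «Keys»; deal (D61)
of the leaf (U4f-χ₁-ram-one), cell «U4-RAM» input (II)-a for socket :155 (U4f-χ₁-ram-one-d0B) in the Z3-c SHARED FRAME v1 (`K2/K2E3-p03/g9/Z3c-frame.v1.txt`);
2026-09-04.  KERNEL module: THEOREMS ONLY (no definition, no named fact, no `sorry`, no instance, no notation).
-/
import Summits.HodgeConjecture.HodgeConjecture.Theorems.K2E3WeightShellSeries               -- ★ B6 p860920 (this seat): `weightIntegral_near_eq` (`G₂ = T₀ + G₁`), `weightIntegral_far_mul_one_sub_eq` (`G₁(1−ρ) = T₁ + ρT₀`); brings ★ B5 (dilation), ★ shell kit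
import Summits.HodgeConjecture.HodgeConjecture.Theorems.K2E3IntertwiningKernelOfReducible     -- ★ V1 p857640 (K2E3-p06 g4): `exists_rpow_modulus_of_contracting` (`|χ₁| = ‖·‖^s`, `s > 0`); brings ★ `exists_map_eq_unitModulusChar_lt_one`
import Summits.HodgeConjecture.HodgeConjecture.Theorems.K2E3BranchBSkewLineIntegrals          -- ★ (K2E3-p03 (g9)) `measurable_dite_isUnit` (the weight `r ↦ g(r̂) ∕ 0` is Borel)
import Literature.NumberTheory.Automorphic.NonsplitPlaceHaarBallRatios                         -- ★ L-β0: `isUnit_toLocalRing_uniformizer`, `conjLocal_toLocalRing_uniformizer`, `valued_toLocalRing_uniformizer_apply` (the σ-fixed uniformiser `ϖ̂ = ι_v ϖ_v`)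
import Literature.NumberTheory.Automorphic.CMLocalRingModulusContinuous                        -- ★ `continuous_unitModulusChar`
import Literature.NumberTheory.Automorphic.AddCharConductorExponent                            -- ★ `normAbs_le_normAbs_iff_valued` (`‖x‖ ≤ ‖y‖ ↔ |x|_v ≤ |y|_v`)
import HarnessLib

/-!
# K2 ∕ E3 «EllipticInputs», unit U4 «Keys» — socket :155 (U4f-χ₁-ram-one-d0B), cell «U4-RAM» input (II)-a IN THE SHARED FRAME v1:
# the SCALING IDENTITY `∫_{S_ge} F₀ = ∫_{Sh0} F₀ + ∫_{Sh1} F₀ + Y²·∫_{S_ge} F₀` and the INTEGRABILITY of `F₀` on `S_ge`, read off ★ B5∕B6 (`K2E3WeightShellDilation`∕`…Series`)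
# through the region dictionary «`Valued.v (z_w) ⋚ 1 ∕ = exp k` ↔ real heights `Π_w′ |z_w′| ⋚ 1 ∕ = ‖ϖ̂‖^{-k}`»   [Casselman1995 §6.4; Keys1984 §3–§4, §7 Thm (2); TateThesis1967 §2.4]

Cell hodgecm-mathlib (D-0151), FLOOR 0, Track B «K2-LIT», engine E3, crux item H413 = stmt-HodgeConjecture-24833 (route `HCCMUnconditional`, no route verbs); target BY NAME
the OPEN socket `…K2E3EllipticInputs.U4Keys.sig_K2E3KeysThmTwoContractingRamifiedCharOneDepthZeroNormTrivial` (U4Keys :155; Keys §7 Thm (2), ramified `χ₁` of depth zero,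
Branch B, inert `v`), through ★ `K2E3KeysThmTwoDepthZeroBranchBInert.exists_eta_of_reducible_of_shellIdentities` (K2E3-p32 (g0)), which closes :155 at an inert place MODULO the
letters `hint` (a), `hscal` (b), `h1` (c), `h0` (d) of the Z3-c frame v1 (K2E3-p03 (g9)).  THIS FILE PAYS (a) AND (b) in the EXACT binder shapes of that theorem:
* §1 the region dictionary (inert `v`, `w ∣ v`, `ϖ̂ = ι_v ϖ_v` the σ-fixed uniformiser unit ★ L-β0): **`setOf_one_le_v_eq`** `{1 ≤ |z_w|} = {1 ≤ m}`, **`setOf_one_lt_v_eq`**,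
  **`setOf_v_eq_one_eq`** `{|z_w| = 1} = {m = (‖ϖ̂‖⁻¹)^0}`, **`setOf_v_eq_exp_one_eq`** `{|z_w| = exp 1} = {m = (‖ϖ̂‖⁻¹)^1}` (`m(n) = Π_w′ ‖(n₀₂)_w′‖ = ‖(n₀₂)_w‖` ★ DICT; ★
  `normAbs_le_normAbs_iff_valued`; `|ϖ̂_w| = exp(−1)` ★ `valued_toLocalRing_uniformizer_apply`).
* §2 **`integral_S_ge_eq`** = letter `hscal` (b): for EVERY `χ₁` with `|Y| < 1`, `Y = χ₁(ϖ̂)`, and `F₀` integrable on `S_ge`: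
  `∫_{S_ge} F₀ = ∫_{Sh0} F₀ + ∫_{Sh1} F₀ + Y²·∫_{S_ge} F₀` — ★ B6 with the weight letter `c := F₀` (`χ₂ = 1`) and `ϖ := ϖ̂`: `ρ = χ₁(ϖ̂·σϖ̂) = Y²` (`σϖ̂ = ϖ̂` ★), `G₂ = T₀ + G₁`,
  `G₁(1−ρ) = T₁ + ρT₀` ⟹ `G₂ = T₀ + T₁ + ρG₂`.  No depth-zero ∕ Branch-B hypothesis is used: (b) is pure torus dilation (★ B5).
* §3 **`integrableOn_F₀_S_ge`** = letter `hint` (a): for `χ₁` continuous and contracting (`|χ₁| = ‖·‖^s`, `s > 0`, ★ V1 §1) and `μ` Haar, `F₀` is integrable on `S_ge = {1 ≤ |z_w|}`: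
  `F₀` is Borel (★ `measurable_dite_isUnit` ∘ the continuous entry `n ↦ n₀₂`), `‖F₀(n)‖ = m(n)^{−(s+1)}` on `S_ge`, and `m^{−(s+1)}` is integrable on `{½ < m}` by the torus-scaling shell bound
  ★ `integrableOn_rpow_neg_of_scaling` (the tail argument of ★ `integrable_cellFun` verbatim, `A = ½`).
HONEST LABEL: HC_CM is proved only modulo the 7 printed citations (2 remaining named inputs: hLiu418 = stmt-HodgeConjecture-24832, h413 = stmt-HodgeConjecture-24833)
until rung 0 closes; count-neutral — this file does NOT pay :155 (letters (c) `h1`, (d) `h0` remain with (II)-a∕(II)-b3); no printed citation is discharged.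

## References
* [Casselman1995] W. Casselman, *Introduction to the theory of admissible representations of `p`-adic reductive groups* (1995), §6.4 p. 63 (shell-by-shell evaluation).
* [Keys1984] D. Keys, *Principal series representations of special unitary groups over local fields*, Compositio Math. 51 (1984), §3–§4, §7 Thm (2) p. 126.
* [TateThesis1967] J. Tate, *Fourier analysis in number fields and Hecke's zeta-functions*, in Cassels–Fröhlich (1967), §2.4.
* [WeilBNT1967] A. Weil, *Basic Number Theory* (1967), Ch. I §4, Ch. II §5 Prop. 12.
-/

set_option autoImplicit false
-- the mandated namespace has the single-problem summit's repeated segment (`HodgeConjecture.HodgeConjecture`)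
set_option linter.dupNamespace false

noncomputable section

open NumberField IsDedekindDomain MeasureTheory
open scoped Matrix MatrixGroups WithZero Valued NNReal ENNReal
open Literature.NumberTheory Literature.NumberTheory.Automorphic Literature.NumberTheory.Automorphic.UnitaryGroup
open Literature.NumberTheory.Rogawski1990 Literature.NumberTheory.GaloisRepresentations Literature.NumberTheory.GaloisRepresentations.IsNonarchimedeanLocalField

namespace Summit.HodgeConjecture.HodgeConjecture.Cruxes.H413.K2E3BranchBShellScalingFromWeightSeries

open Summit.HodgeConjecture.HodgeConjecture.Cruxes.H413

-- every statement carries the coercion chain `((n : ↥U) : GL) : Matrix) 0 2`: generous instance budget for the whole module (lesson of ★ B6)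
set_option synthInstance.maxHeartbeats 400000
set_option maxHeartbeats 6000000

open Classical

variable (L : Type) [Field L] [NumberField L] [IsCMField L] (v : HeightOneSpectrum (𝓞 ↥(maximalRealSubfield L)))
  (w : PlacesOver L v) (hw : IsCMField.complexConj L • w.1 = w.1)

/-! ## §1 The region dictionary: `Valued.v ((n₀₂)_w)` versus the real height `m(n) = Π_w′ ‖(n₀₂)_w′‖` -/

include hw in
/-- `m(n) = ‖(n₀₂)_w‖` at a non-split `v` (one place `w ∣ v`, ★ DICT `prod_normAbs_eq_normAbs_apply`). [cite: WeilBNT1967, Ch. I §4] -/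
theorem height_eq_coe_normAbs (u : ↥(cmBorelTriple L 3 v).N) :
    (((∏ w' : PlacesOver L v, normAbs (w'.1.adicCompletion L) ((((((u : ↥(unitaryGroupOfForm (conjLocal L (IsCMField.complexConj L) v) (cmLocalForm L 3 v)))) : GL (Fin 3) (LocalRing L v)) : Matrix (Fin 3) (Fin 3) (LocalRing L v)) 0 2) w')) : ℝ≥0) : ℝ) = ((normAbs (w.1.adicCompletion L) (((((u : ↥(unitaryGroupOfForm (conjLocal L (IsCMField.complexConj L) v) (cmLocalForm L 3 v))) : GL (Fin 3) (LocalRing L v)) : Matrix (Fin 3) (Fin 3) (LocalRing L v)) 0 2) w) : ℝ≥0) : ℝ) := by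
  rw [F0P3cStCharTSLocalRingNormDictionary.prod_normAbs_eq_normAbs_apply L v w hw]

omit [IsCMField L] in
/-- `‖x‖ = ‖y‖ ↔ |x|_w = |y|_w` on `L_w` (★ `normAbs_le_normAbs_iff_valued` both ways). [cite: WeilBNT1967, Ch. I §4] -/
theorem normAbs_eq_iff_valued_eq (x y : w.1.adicCompletion L) :
    normAbs (w.1.adicCompletion L) x = normAbs (w.1.adicCompletion L) y ↔ Valued.v x = Valued.v y :=
  ⟨fun h => le_antisymm ((normAbs_le_normAbs_iff_valued w.1 x y).1 h.le) ((normAbs_le_normAbs_iff_valued w.1 y x).1 h.ge),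
    fun h => le_antisymm ((normAbs_le_normAbs_iff_valued w.1 x y).2 h.le) ((normAbs_le_normAbs_iff_valued w.1 y x).2 h.ge)⟩

include hw in
/-- **`{n | 1 ≤ |(n₀₂)_w|_w} = {n | 1 ≤ m(n)}`** (frame-v1 `S_ge` = ★ B6's `{1 ≤ m}`). [cite: Casselman1995, §6.4 p. 63] -/
theorem setOf_one_le_v_eq : {m : ↥(cmBorelTriple L 3 v).N | 1 ≤ Valued.v (((((m : ↥(unitaryGroupOfForm (conjLocal L (IsCMField.complexConj L) v) (cmLocalForm L 3 v))) : GL (Fin 3) (LocalRing L v)) : Matrix (Fin 3) (Fin 3) (LocalRing L v)) 0 2) w)} = {u : ↥(cmBorelTriple L 3 v).N | 1 ≤ (((∏ w' : PlacesOver L v, normAbs (w'.1.adicCompletion L) ((((((u : ↥(unitaryGroupOfForm (conjLocal L (IsCMField.complexConj L) v) (cmLocalForm L 3 v)))) : GL (Fin 3) (LocalRing L v)) : Matrix (Fin 3) (Fin 3) (LocalRing L v)) 0 2) w')) : ℝ≥0) : ℝ)} := by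
  ext m
  simp only [Set.mem_setOf_eq]
  rw [height_eq_coe_normAbs L v w hw, ← NNReal.coe_one, NNReal.coe_le_coe, ← map_one (normAbs (w.1.adicCompletion L)),
    normAbs_le_normAbs_iff_valued, map_one]

include hw in
/-- **`{n | 1 < |(n₀₂)_w|_w} = {n | 1 < m(n)}`** (frame-v1 `S_gt` = ★ B6's `{1 < m}`). [cite: Casselman1995, §6.4 p. 63] -/
theorem setOf_one_lt_v_eq : {m : ↥(cmBorelTriple L 3 v).N | 1 < Valued.v (((((m : ↥(unitaryGroupOfForm (conjLocal L (IsCMField.complexConj L) v) (cmLocalForm L 3 v))) : GL (Fin 3) (LocalRing L v)) : Matrix (Fin 3) (Fin 3) (LocalRing L v)) 0 2) w)} = {u : ↥(cmBorelTriple L 3 v).N | 1 < (((∏ w' : PlacesOver L v, normAbs (w'.1.adicCompletion L) ((((((u : ↥(unitaryGroupOfForm (conjLocal L (IsCMField.complexConj L) v) (cmLocalForm L 3 v)))) : GL (Fin 3) (LocalRing L v)) : Matrix (Fin 3) (Fin 3) (LocalRing L v)) 0 2) w')) : ℝ≥0) : ℝ)} := by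
  ext m
  simp only [Set.mem_setOf_eq]
  rw [height_eq_coe_normAbs L v w hw, ← NNReal.coe_one, NNReal.coe_lt_coe, ← not_le, ← not_le, ← map_one (normAbs (w.1.adicCompletion L)),
    normAbs_le_normAbs_iff_valued, map_one]

include hw in
/-- **`{n | |(n₀₂)_w|_w = 1} = {n | m(n) = (‖ϖ̂‖⁻¹)^0}`** (frame-v1 shell `Sh 0` = ★ B6's `S_0`). [cite: Casselman1995, §6.4 p. 63] -/
theorem setOf_v_eq_one_eq : {m : ↥(cmBorelTriple L 3 v).N | Valued.v (((((m : ↥(unitaryGroupOfForm (conjLocal L (IsCMField.complexConj L) v) (cmLocalForm L 3 v))) : GL (Fin 3) (LocalRing L v)) : Matrix (Fin 3) (Fin 3) (LocalRing L v)) 0 2) w) = 1} = {u : ↥(cmBorelTriple L 3 v).N | (((∏ w' : PlacesOver L v, normAbs (w'.1.adicCompletion L) ((((((u : ↥(unitaryGroupOfForm (conjLocal L (IsCMField.complexConj L) v) (cmLocalForm L 3 v)))) : GL (Fin 3) (LocalRing L v)) : Matrix (Fin 3) (Fin 3) (LocalRing L v)) 0 2) w')) : ℝ≥0) : ℝ)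 = ((((unitModulusChar (LocalRing L v) (isUnit_toLocalRing_uniformizer L v).unit : ℝ≥0) : ℝ))⁻¹) ^ 0} := by
  ext m
  simp only [Set.mem_setOf_eq]
  rw [pow_zero, height_eq_coe_normAbs L v w hw, ← NNReal.coe_one, NNReal.coe_inj, ← map_one (normAbs (w.1.adicCompletion L)),
    normAbs_eq_iff_valued_eq L v w, map_one]

include hw in
/-- **`{n | |(n₀₂)_w|_w = exp 1} = {n | m(n) = (‖ϖ̂‖⁻¹)^1}`** at an INERT `v` (frame-v1 shell `Sh 1` = ★ B6's `S_1` for `ϖ := ϖ̂ = ι_v ϖ_v`): `‖ϖ̂‖ = ‖ϖ̂_w‖` (★ `unitModulusChar_localRing_eq_prod` + ★ DICT),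
`|ϖ̂_w| = exp(−1)` (★ `valued_toLocalRing_uniformizer_apply`), so `m(n) = ‖ϖ̂_w‖⁻¹ = ‖ϖ̂_w⁻¹‖ ↔ |(n₀₂)_w| = |ϖ̂_w⁻¹| = exp 1`. [cite: Casselman1995, §6.4 p. 63] [cite: WeilBNT1967, Ch. I §4] -/
theorem setOf_v_eq_exp_one_eq (hunr : Algebra.IsUnramifiedIn (𝓞 L) v.asIdeal) : {m : ↥(cmBorelTriple L 3 v).N | Valued.v (((((m : ↥(unitaryGroupOfForm (conjLocal L (IsCMField.complexConj L) v) (cmLocalForm L 3 v))) : GL (Fin 3) (LocalRing L v)) : Matrix (Fin 3) (Fin 3) (LocalRing L v)) 0 2) w) = WithZero.exp (1 : ℤ)} = {u : ↥(cmBorelTriple L 3 v).N | (((∏ w' : PlacesOver L v, normAbs (w'.1.adicCompletion L) ((((((u : ↥(unitaryGroupOfForm (conjLocal L (IsCMField.complexConj L) v) (cmLocalForm L 3 v)))) : GL (Fin 3) (LocalRing L v)) : Matrix (Fin 3) (Fin 3) (LocalRing L v)) 0 2) w')) : ℝ≥0) : ℝ) = ((((unitModulusChar (LocalRing L v) (isUnit_toLocalRing_uniformizer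 L v).unit : ℝ≥0) : ℝ))⁻¹) ^ 1} := by
  have hϖw : Valued.v ((((isUnit_toLocalRing_uniformizer L v).unit : (LocalRing L v)ˣ) : LocalRing L v) w) = WithZero.exp (-1 : ℤ) := valued_toLocalRing_uniformizer_apply L v w hunr
  have ha : ((unitModulusChar (LocalRing L v) (isUnit_toLocalRing_uniformizer L v).unit : ℝ≥0) : ℝ) = ((normAbs (w.1.adicCompletion L) ((((isUnit_toLocalRing_uniformizer L v).unit : (LocalRing L v)ˣ) : LocalRing L v) w) : ℝ≥0) : ℝ) := by
    rw [unitModulusChar_localRing_eq_prod, F0P3cStCharTSLocalRingNormDictionary.prod_normAbs_eq_normAbs_apply L v w hw]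
  ext m
  simp only [Set.mem_setOf_eq]
  rw [pow_one, height_eq_coe_normAbs L v w hw, ha, ← NNReal.coe_inv, NNReal.coe_inj, ← map_inv₀, normAbs_eq_iff_valued_eq L v w, map_inv₀, hϖw,
    ← WithZero.exp_neg, neg_neg]

/-! ## §2 Letter (b) `hscal`: the scaling identity of the weight integral on `S_ge` -/

include hw in
/-- **(II)-a ∕ letter `hscal`: `∫_{S_ge} F₀ = ∫_{Sh0} F₀ + ∫_{Sh1} F₀ + Y² · ∫_{S_ge} F₀`** — `v` non-split and UNRAMIFIED in `L` (inert), `w ∣ v`, `μ` a Haar measure on `N(L⁺_v)`,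
`χ₁ : (L ⊗ L⁺_v)ˣ → ℂˣ` ANY homomorphism with `|Y| < 1` for `Y = χ₁(ϖ̂)` (`ϖ̂ = ι_v ϖ_v` the σ-fixed uniformiser unit), `F₀(n) = χ₁(σ n₀₂)⁻¹‖n₀₂‖⁻¹` (a unit `n₀₂`; else `0`) integrable
on `S_ge = {1 ≤ |(n₀₂)_w|}`; `Sh0 = {|(n₀₂)_w| = 1}`, `Sh1 = {|(n₀₂)_w| = exp 1}`.  PROOF: ★ B6 `K2E3WeightShellSeries` with the weight letter `c := F₀` (`χ₂ = 1`) and `ϖ := ϖ̂`: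
`G₂ = T₀ + G₁` (`weightIntegral_near_eq`) and `G₁·(1 − ρ) = T₁ + ρ·T₀` (`weightIntegral_far_mul_one_sub_eq`, ★ B5 dilation) with `ρ = χ₁(ϖ̂·σϖ̂) = Y²` (`σϖ̂ = ϖ̂` ★
`conjLocal_toLocalRing_uniformizer`), whence `G₂ = T₀ + T₁ + ρ·G₂`; the regions are translated by §1.  Binder shapes = those of ★
`K2E3KeysThmTwoDepthZeroBranchBInert.exists_eta_of_reducible_of_shellIdentities` (letter `hscal`). [cite: Casselman1995, §6.4 p. 63] [cite: Keys1984, §3–§4] [cite: TateThesis1967, §2.4] -/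
theorem integral_S_ge_eq (hns : ∀ w' : PlacesOver L v, IsCMField.complexConj L • w'.1 = w'.1) (hunr : Algebra.IsUnramifiedIn (𝓞 L) v.asIdeal)
    (χ₁ : (LocalRing L v)ˣ →* ℂˣ)
    [MeasurableSpace ↥(cmBorelTriple L 3 v).N] [BorelSpace ↥(cmBorelTriple L 3 v).N] (μ : Measure ↥(cmBorelTriple L 3 v).N) [μ.IsHaarMeasure]
    (hY : ‖((χ₁ (isUnit_toLocalRing_uniformizer L v).unit : ℂˣ) : ℂ)‖ < 1)
    (hint : IntegrableOn (fun n : ↥(cmBorelTriple L 3 v).N =>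
        if h : IsUnit ((((n : ↥(unitaryGroupOfForm (conjLocal L (IsCMField.complexConj L) v) (cmLocalForm L 3 v))) : GL (Fin 3) (LocalRing L v)) : Matrix (Fin 3) (Fin 3) (LocalRing L v)) 0 2) then
          ((((χ₁ (Units.map ((conjLocal L (IsCMField.complexConj L) v) : LocalRing L v →* LocalRing L v) h.unit))⁻¹ : ℂˣ) : ℂ) *
            ((((unitModulusChar (LocalRing L v) h.unit)⁻¹ : ℝ≥0) : ℝ) : ℂ))
        else 0) {m : ↥(cmBorelTriple L 3 v).N | 1 ≤ Valued.v (((((m : ↥(unitaryGroupOfForm (conjLocal L (IsCMField.complexConj L) v) (cmLocalForm L 3 v))) : GL (Fin 3) (LocalRing L v)) : Matrix (Fin 3) (Fin 3) (LocalRing L v)) 0 2) w)} μ) :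
    ∫ n in {m : ↥(cmBorelTriple L 3 v).N | 1 ≤ Valued.v (((((m : ↥(unitaryGroupOfForm (conjLocal L (IsCMField.complexConj L) v) (cmLocalForm L 3 v))) : GL (Fin 3) (LocalRing L v)) : Matrix (Fin 3) (Fin 3) (LocalRing L v)) 0 2) w)}, (fun n : ↥(cmBorelTriple L 3 v).N =>
        if h : IsUnit ((((n : ↥(unitaryGroupOfForm (conjLocal L (IsCMField.complexConj L) v) (cmLocalForm L 3 v))) : GL (Fin 3) (LocalRing L v)) : Matrix (Fin 3) (Fin 3) (LocalRing L v)) 0 2) then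
          ((((χ₁ (Units.map ((conjLocal L (IsCMField.complexConj L) v) : LocalRing L v →* LocalRing L v) h.unit))⁻¹ : ℂˣ) : ℂ) *
            ((((unitModulusChar (LocalRing L v) h.unit)⁻¹ : ℝ≥0) : ℝ) : ℂ))
        else 0) n ∂μ =
      (∫ n in {m : ↥(cmBorelTriple L 3 v).N | Valued.v (((((m : ↥(unitaryGroupOfForm (conjLocal L (IsCMField.complexConj L) v) (cmLocalForm L 3 v))) : GL (Fin 3) (LocalRing L v)) : Matrix (Fin 3) (Fin 3) (LocalRing L v)) 0 2) w) = 1}, (fun n : ↥(cmBorelTriple L 3 v).N =>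
        if h : IsUnit ((((n : ↥(unitaryGroupOfForm (conjLocal L (IsCMField.complexConj L) v) (cmLocalForm L 3 v))) : GL (Fin 3) (LocalRing L v)) : Matrix (Fin 3) (Fin 3) (LocalRing L v)) 0 2) then
          ((((χ₁ (Units.map ((conjLocal L (IsCMField.complexConj L) v) : LocalRing L v →* LocalRing L v) h.unit))⁻¹ : ℂˣ) : ℂ) *
            ((((unitModulusChar (LocalRing L v) h.unit)⁻¹ : ℝ≥0) : ℝ) : ℂ))
        else 0) n ∂μ) + (∫ n in {m : ↥(cmBorelTriple L 3 v).N | Valued.v (((((m : ↥(unitaryGroupOfForm (conjLocal L (IsCMField.complexConj L) v) (cmLocalForm L 3 v))) : GL (Fin 3) (LocalRing L v)) : Matrix (Fin 3) (Fin 3) (LocalRing L v)) 0 2) w) = WithZero.exp (1 : ℤ)}, (fun n : ↥(cmBorelTriple L 3 v).N =>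
        if h : IsUnit ((((n : ↥(unitaryGroupOfForm (conjLocal L (IsCMField.complexConj L) v) (cmLocalForm L 3 v))) : GL (Fin 3) (LocalRing L v)) : Matrix (Fin 3) (Fin 3) (LocalRing L v)) 0 2) then
          ((((χ₁ (Units.map ((conjLocal L (IsCMField.complexConj L) v) : LocalRing L v →* LocalRing L v) h.unit))⁻¹ : ℂˣ) : ℂ) *
            ((((unitModulusChar (LocalRing L v) h.unit)⁻¹ : ℝ≥0) : ℝ) : ℂ))
        else 0) n ∂μ) +
        ((χ₁ (isUnit_toLocalRing_uniformizer L v).unit : ℂˣ) : ℂ) ^ 2 * ∫ n in {m : ↥(cmBorelTriple L 3 v).N | 1 ≤ Valued.v (((((m : ↥(unitaryGroupOfForm (conjLocal L (IsCMField.complexConj L) v) (cmLocalForm L 3 v))) : GL (Fin 3) (LocalRing L v)) : Matrix (Fin 3) (Fin 3) (LocalRing L v)) 0 2) w)}, (fun n : ↥(cmBorelTriple L 3 v).N =>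
        if h : IsUnit ((((n : ↥(unitaryGroupOfForm (conjLocal L (IsCMField.complexConj L) v) (cmLocalForm L 3 v))) : GL (Fin 3) (LocalRing L v)) : Matrix (Fin 3) (Fin 3) (LocalRing L v)) 0 2) then
          ((((χ₁ (Units.map ((conjLocal L (IsCMField.complexConj L) v) : LocalRing L v →* LocalRing L v) h.unit))⁻¹ : ℂˣ) : ℂ) *
            ((((unitModulusChar (LocalRing L v) h.unit)⁻¹ : ℝ≥0) : ℝ) : ℂ))
        else 0) n ∂μ := by
  -- the σ-fixed uniformiser unit `ϖ̂` and `ρ = χ₁(ϖ̂·σϖ̂) = Y²`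
  have hϖ' : ∀ w' : PlacesOver L v, Valued.v ((((isUnit_toLocalRing_uniformizer L v).unit : (LocalRing L v)ˣ) : LocalRing L v) w') = WithZero.exp (-1 : ℤ) :=
    fun w' => valued_toLocalRing_uniformizer_apply L v w' hunr
  have hσϖ : Units.map (conjLocal L (IsCMField.complexConj L) v : LocalRing L v →* LocalRing L v) (isUnit_toLocalRing_uniformizer L v).unit = (isUnit_toLocalRing_uniformizer L v).unit :=
    Units.ext (by rw [Units.coe_map, MonoidHom.coe_coe]; exact conjLocal_toLocalRing_uniformizer L v)
  have hρ : ((χ₁ ((isUnit_toLocalRing_uniformizer L v).unit * Units.map (conjLocal L (IsCMField.complexConj L) v : LocalRing L v →* LocalRing L v) (isUnit_toLocalRing_uniformizer L v).unit) : ℂˣ) : ℂ) = ((χ₁ (isUnit_toLocalRing_uniformizer L v).unit : ℂˣ) : ℂ) ^ 2 := by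
    rw [hσϖ, ← sq, map_pow, Units.val_pow_eq_pow_val]
  have hρ1 : ‖((χ₁ ((isUnit_toLocalRing_uniformizer L v).unit * Units.map (conjLocal L (IsCMField.complexConj L) v : LocalRing L v →* LocalRing L v) (isUnit_toLocalRing_uniformizer L v).unit) : ℂˣ) : ℂ)‖ < 1 := by
    rw [hρ, norm_pow]
    exact pow_lt_one₀ (norm_nonneg _) hY two_ne_zero
  -- the weight letter: `F₀` is ★ B6's weight for `(χ₁, χ₂) = (χ₁, 1)`
  have hc : ∀ u : ↥(cmBorelTriple L 3 v).N, (fun n : ↥(cmBorelTriple L 3 v).N =>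
        if h : IsUnit ((((n : ↥(unitaryGroupOfForm (conjLocal L (IsCMField.complexConj L) v) (cmLocalForm L 3 v))) : GL (Fin 3) (LocalRing L v)) : Matrix (Fin 3) (Fin 3) (LocalRing L v)) 0 2) then
          ((((χ₁ (Units.map ((conjLocal L (IsCMField.complexConj L) v) : LocalRing L v →* LocalRing L v) h.unit))⁻¹ : ℂˣ) : ℂ) *
            ((((unitModulusChar (LocalRing L v) h.unit)⁻¹ : ℝ≥0) : ℝ) : ℂ))
        else 0) u =
      (if hb : IsUnit (((((u : ↥(unitaryGroupOfForm (conjLocal L (IsCMField.complexConj L) v) (cmLocalForm L 3 v)))) : GL (Fin 3) (LocalRing L v)) : Matrix (Fin 3) (Fin 3) (LocalRing L v)) 0 2) then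
          ((((χ₁ (Units.map (conjLocal L (IsCMField.complexConj L) v : LocalRing L v →* LocalRing L v) hb.unit))⁻¹ : ℂˣ) : ℂ) *
            (((1 : ↥(normOneUnits (conjLocal L (IsCMField.complexConj L) v)) →* ℂˣ) ⟨-1, F0P3cStCharTSBigCellFactorisation.neg_one_mem_normOneUnits (conjLocal L (IsCMField.complexConj L) v)⟩ : ℂˣ) : ℂ) *
            ((((unitModulusChar (LocalRing L v) hb.unit)⁻¹ : ℝ≥0) : ℝ) : ℂ))
        else 0) := by
    intro u
    show (if h : IsUnit ((((u : ↥(unitaryGroupOfForm (conjLocal L (IsCMField.complexConj L) v) (cmLocalForm L 3 v))) : GL (Fin 3) (LocalRing L v)) : Matrix (Fin 3) (Fin 3) (LocalRing L v)) 0 2) then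
          ((((χ₁ (Units.map ((conjLocal L (IsCMField.complexConj L) v) : LocalRing L v →* LocalRing L v) h.unit))⁻¹ : ℂˣ) : ℂ) *
            ((((unitModulusChar (LocalRing L v) h.unit)⁻¹ : ℝ≥0) : ℝ) : ℂ))
        else 0) = _
    by_cases hb : IsUnit ((((u : ↥(unitaryGroupOfForm (conjLocal L (IsCMField.complexConj L) v) (cmLocalForm L 3 v))) : GL (Fin 3) (LocalRing L v)) : Matrix (Fin 3) (Fin 3) (LocalRing L v)) 0 2)
    · rw [dif_pos hb, dif_pos hb, MonoidHom.one_apply, Units.val_one, mul_one]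
    · rw [dif_neg hb, dif_neg hb]
  -- regions in height currency
  have hsub : {u : ↥(cmBorelTriple L 3 v).N | 1 < (((∏ w' : PlacesOver L v, normAbs (w'.1.adicCompletion L) ((((((u : ↥(unitaryGroupOfForm (conjLocal L (IsCMField.complexConj L) v) (cmLocalForm L 3 v)))) : GL (Fin 3) (LocalRing L v)) : Matrix (Fin 3) (Fin 3) (LocalRing L v)) 0 2) w')) : ℝ≥0) : ℝ)} ⊆ {u : ↥(cmBorelTriple L 3 v).N | 1 ≤ (((∏ w' : PlacesOver L v, normAbs (w'.1.adicCompletion L) ((((((u : ↥(unitaryGroupOfForm (conjLocal L (IsCMField.complexConj L) v) (cmLocalForm L 3 v)))) : GL (Fin 3) (LocalRing L v)) : Matrix (Fin 3) (Fin 3) (LocalRing L v)) 0 2) w')) : ℝ≥0) : ℝ)} :=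
    fun u hu => by rw [Set.mem_setOf_eq] at hu ⊢; exact le_of_lt hu
  have hint' : IntegrableOn (fun n : ↥(cmBorelTriple L 3 v).N =>
        if h : IsUnit ((((n : ↥(unitaryGroupOfForm (conjLocal L (IsCMField.complexConj L) v) (cmLocalForm L 3 v))) : GL (Fin 3) (LocalRing L v)) : Matrix (Fin 3) (Fin 3) (LocalRing L v)) 0 2) then
          ((((χ₁ (Units.map ((conjLocal L (IsCMField.complexConj L) v) : LocalRing L v →* LocalRing L v) h.unit))⁻¹ : ℂˣ) : ℂ) *
            ((((unitModulusChar (LocalRing L v) h.unit)⁻¹ : ℝ≥0) : ℝ) : ℂ))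
        else 0) {u : ↥(cmBorelTriple L 3 v).N | 1 ≤ (((∏ w' : PlacesOver L v, normAbs (w'.1.adicCompletion L) ((((((u : ↥(unitaryGroupOfForm (conjLocal L (IsCMField.complexConj L) v) (cmLocalForm L 3 v)))) : GL (Fin 3) (LocalRing L v)) : Matrix (Fin 3) (Fin 3) (LocalRing L v)) 0 2) w')) : ℝ≥0) : ℝ)} μ := by
    rw [← setOf_one_le_v_eq L v w hw]; exact hint
  have hnear := K2E3WeightShellSeries.weightIntegral_near_eq L v hns (isUnit_toLocalRing_uniformizer L v).unit hϖ' μ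
    (fun n : ↥(cmBorelTriple L 3 v).N =>
        if h : IsUnit ((((n : ↥(unitaryGroupOfForm (conjLocal L (IsCMField.complexConj L) v) (cmLocalForm L 3 v))) : GL (Fin 3) (LocalRing L v)) : Matrix (Fin 3) (Fin 3) (LocalRing L v)) 0 2) then
          ((((χ₁ (Units.map ((conjLocal L (IsCMField.complexConj L) v) : LocalRing L v →* LocalRing L v) h.unit))⁻¹ : ℂˣ) : ℂ) *
            ((((unitModulusChar (LocalRing L v) h.unit)⁻¹ : ℝ≥0) : ℝ) : ℂ))
        else 0) hint'
  have hfar := K2E3WeightShellSeries.weightIntegral_far_mul_one_sub_eq L v hns χ₁ 1 (isUnit_toLocalRing_uniformizer L v).unit hϖ' μ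
    (fun n : ↥(cmBorelTriple L 3 v).N =>
        if h : IsUnit ((((n : ↥(unitaryGroupOfForm (conjLocal L (IsCMField.complexConj L) v) (cmLocalForm L 3 v))) : GL (Fin 3) (LocalRing L v)) : Matrix (Fin 3) (Fin 3) (LocalRing L v)) 0 2) then
          ((((χ₁ (Units.map ((conjLocal L (IsCMField.complexConj L) v) : LocalRing L v →* LocalRing L v) h.unit))⁻¹ : ℂˣ) : ℂ) *
            ((((unitModulusChar (LocalRing L v) h.unit)⁻¹ : ℝ≥0) : ℝ) : ℂ))
        else 0) hc hρ1 (hint'.mono_set hsub)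
  rw [hρ] at hfar
  rw [setOf_one_le_v_eq L v w hw, setOf_v_eq_one_eq L v w hw, setOf_v_eq_exp_one_eq L v w hw hunr]
  linear_combination (1 - ((χ₁ (isUnit_toLocalRing_uniformizer L v).unit : ℂˣ) : ℂ) ^ 2) * hnear + hfar

/-! ## §3 Letter (a) `hint`: `F₀` is integrable on `S_ge` -/

include hw in
/-- **(II)-a ∕ letter `hint`: `F₀` IS INTEGRABLE ON `S_ge = {1 ≤ |(n₀₂)_w|}`** for `v` non-split, `μ` Haar on `N(L⁺_v)`, `χ₁` continuous and CONTRACTING (then `|χ₁| = ‖·‖^s` with `s > 0`, ★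
`exists_rpow_modulus_of_contracting`; no depth ∕ branch hypothesis).  `F₀ = G ∘ (n ↦ n₀₂)` with `G(r) = χ₁(σr̂)⁻¹‖r̂‖⁻¹` (`r` a unit) `∕ 0` Borel (★ `measurable_dite_isUnit`; `χ₁`, `σ`,
`‖·‖` continuous ★); on `S_ge` the entry is a unit and `‖F₀(n)‖ = ‖σ n̂₀₂‖^{−s}·‖n̂₀₂‖⁻¹ = m(n)^{−(s+1)}` (`‖σx‖ = ‖x‖` ★ `distribHaarChar_map_eq`); and `m^{−(s+1)}` is integrable on
`{½ < m} ⊇ S_ge`: the torus `t = d(α, ·, σα⁻¹)`, `‖α‖ < 1`, dilates heights by `‖α‖⁻²` and Haar measure by `‖α‖²`, `‖α‖²·(‖α‖⁻²)^{s+1} > 1` (★ `integrableOn_rpow_neg_of_scaling`, the tail of ★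
`integrable_cellFun`).  Binder shape = letter `hint` of ★ `…BranchBInert.exists_eta_of_reducible_of_shellIdentities`. [cite: Casselman1995, §6.4 pp. 62–64] [cite: Keys1984, §3] [cite: WeilBNT1967, Ch. II §5 Prop. 12] -/
theorem integrableOn_F₀_S_ge (hns : ∀ w' : PlacesOver L v, IsCMField.complexConj L • w'.1 = w'.1)
    (χ₁ : (LocalRing L v)ˣ →* ℂˣ) (h₁ : Continuous fun x => ((χ₁ x : ℂˣ) : ℂ))
    (hcontr : ∀ x : (LocalRing L v)ˣ, unitModulusChar (LocalRing L v) x < 1 → ‖((χ₁ x : ℂˣ) : ℂ)‖ < 1)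
    [MeasurableSpace ↥(cmBorelTriple L 3 v).N] [BorelSpace ↥(cmBorelTriple L 3 v).N] (μ : Measure ↥(cmBorelTriple L 3 v).N) [μ.IsHaarMeasure] :
    IntegrableOn (fun n : ↥(cmBorelTriple L 3 v).N =>
        if h : IsUnit ((((n : ↥(unitaryGroupOfForm (conjLocal L (IsCMField.complexConj L) v) (cmLocalForm L 3 v))) : GL (Fin 3) (LocalRing L v)) : Matrix (Fin 3) (Fin 3) (LocalRing L v)) 0 2) then
          ((((χ₁ (Units.map ((conjLocal L (IsCMField.complexConj L) v) : LocalRing L v →* LocalRing L v) h.unit))⁻¹ : ℂˣ) : ℂ) *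
            ((((unitModulusChar (LocalRing L v) h.unit)⁻¹ : ℝ≥0) : ℝ) : ℂ))
        else 0) {m : ↥(cmBorelTriple L 3 v).N | 1 ≤ Valued.v (((((m : ↥(unitaryGroupOfForm (conjLocal L (IsCMField.complexConj L) v) (cmLocalForm L 3 v))) : GL (Fin 3) (LocalRing L v)) : Matrix (Fin 3) (Fin 3) (LocalRing L v)) 0 2) w)} μ := by
  haveI := locallyCompactSpace_cmBorelU L 3 v
  letI : MeasurableSpace (LocalRing L v) := borel _
  haveI : BorelSpace (LocalRing L v) := ⟨rfl⟩
  rw [setOf_one_le_v_eq L v w hw]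
  obtain ⟨s, hs, hχ⟩ := K2E3IntertwiningKernelOfReducible.exists_rpow_modulus_of_contracting L v hns χ₁ h₁ hcontr
  -- `F₀` is Borel
  have hg : Continuous fun u : (LocalRing L v)ˣ => ((((χ₁ (Units.map ((conjLocal L (IsCMField.complexConj L) v) : LocalRing L v →* LocalRing L v) u))⁻¹ : ℂˣ) : ℂ) * ((((unitModulusChar (LocalRing L v) u)⁻¹ : ℝ≥0) : ℝ) : ℂ)) := by
    refine Continuous.mul ?_ ?_
    · have hmap : Continuous (Units.map ((conjLocal L (IsCMField.complexConj L) v) : LocalRing L v →* LocalRing L v)) :=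
        Continuous.units_map _ (continuous_conjLocal L (IsCMField.complexConj L) v)
      have h1 : Continuous fun u : (LocalRing L v)ˣ => ((χ₁ (Units.map ((conjLocal L (IsCMField.complexConj L) v) : LocalRing L v →* LocalRing L v) u) : ℂˣ) : ℂ) := h₁.comp hmap
      have he : (fun u : (LocalRing L v)ˣ => ((((χ₁ (Units.map ((conjLocal L (IsCMField.complexConj L) v) : LocalRing L v →* LocalRing L v) u))⁻¹ : ℂˣ) : ℂ))) = fun u => (((χ₁ (Units.map ((conjLocal L (IsCMField.complexConj L) v) : LocalRing L v →* LocalRing L v) u) : ℂˣ) : ℂ))⁻¹ :=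
        funext fun u => Units.val_inv_eq_inv_val _
      rw [he]
      exact h1.inv₀ fun u => Units.ne_zero _
    · exact Complex.continuous_ofReal.comp (NNReal.continuous_coe.comp ((continuous_unitModulusChar L v).inv₀ fun u => (distribHaarChar_pos).ne'))
  have hZ : Measurable fun n : ↥(cmBorelTriple L 3 v).N => (((n : ↥(unitaryGroupOfForm (conjLocal L (IsCMField.complexConj L) v) (cmLocalForm L 3 v))) : GL (Fin 3) (LocalRing L v)) : Matrix (Fin 3) (Fin 3) (LocalRing L v)) 0 2 :=
    (((Units.continuous_val.comp continuous_subtype_val).matrix_elem 0 2).comp continuous_subtype_val).measurable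
  have hF : Measurable (fun n : ↥(cmBorelTriple L 3 v).N =>
        if h : IsUnit ((((n : ↥(unitaryGroupOfForm (conjLocal L (IsCMField.complexConj L) v) (cmLocalForm L 3 v))) : GL (Fin 3) (LocalRing L v)) : Matrix (Fin 3) (Fin 3) (LocalRing L v)) 0 2) then
          ((((χ₁ (Units.map ((conjLocal L (IsCMField.complexConj L) v) : LocalRing L v →* LocalRing L v) h.unit))⁻¹ : ℂˣ) : ℂ) *
            ((((unitModulusChar (LocalRing L v) h.unit)⁻¹ : ℝ≥0) : ℝ) : ℂ))
        else 0) :=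
    (K2E3BranchBSkewLineIntegrals.measurable_dite_isUnit L v w hw _ hg).comp hZ
  -- the tail bound `m^{-(s+1)}` is integrable on `{1/2 < m}` (torus scaling, the tail of ★ `integrable_cellFun`)
  obtain ⟨α, -, hα⟩ := exists_map_eq_unitModulusChar_lt_one (L := L) (v := v) (conjLocal L (IsCMField.complexConj L) v)
  set t : ↥(cmBorelTriple L 3 v).M := F0P3cStCharTSTorusDefs.torusChart L v (α, 1) with ht
  have hd : glDiagonal 3 (LocalRing L v) (F0P3cStCharTSTorusDefs.torusChartEntries L v (α, 1)) = ((t : ↥(unitaryGroupOfForm (conjLocal L (IsCMField.complexConj L) v) (cmLocalForm L 3 v))) : GL (Fin 3) (LocalRing L v)) :=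
    (F0P3cStCharTSTorusDefs.coe_torusChart L v (α, 1)).symm
  have hd0 : F0P3cStCharTSTorusDefs.torusChartEntries L v (α, 1) 0 = α := rfl
  set a : ℝ := ((unitModulusChar (LocalRing L v) α : ℝ≥0) : ℝ) with ha
  have ha0 : 0 < a := NNReal.coe_pos.2 distribHaarChar_pos
  have ha1 : a < 1 := by rw [ha, ← NNReal.coe_one]; exact NNReal.coe_lt_coe.2 hα
  have hA : 0 < a * a := mul_pos ha0 ha0
  have hA1 : a * a < 1 := mul_lt_one_of_nonneg_of_lt_one_left ha0.le ha1 ha1.le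
  have hm : Measurable fun u : ↥(cmBorelTriple L 3 v).N => (((∏ w' : PlacesOver L v, normAbs (w'.1.adicCompletion L) ((((((u : ↥(unitaryGroupOfForm (conjLocal L (IsCMField.complexConj L) v) (cmLocalForm L 3 v)))) : GL (Fin 3) (LocalRing L v)) : Matrix (Fin 3) (Fin 3) (LocalRing L v)) 0 2) w')) : ℝ≥0) : ℝ) :=
    (F0P3cStCharTSKeys3AnnulusDock.continuous_norm_entry L v).measurable
  have hcj : Measurable (HeisRing.torusConj (conjLocal L (IsCMField.complexConj L) v) t) :=
    (HeisRing.continuous_torusConj (conjLocal L (IsCMField.complexConj L) v) t).measurable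
  have hκ := map_torusConj_cmBorel_eq_modularCharacter_nnreal_smul L v t μ
  have hκval : (Measure.modularCharacter (⟨(t : ↥(unitaryGroupOfForm (conjLocal L (IsCMField.complexConj L) v) (cmLocalForm L 3 v))), torusU_le_borelU _ _ t.2⟩ : ↥(cmBorelTriple L 3 v).P) : ℝ≥0) =
      unitModulusChar (LocalRing L v) α * unitModulusChar (LocalRing L v) α := by
    rw [F0P2oBorelTorusModulus.modularCharacter_cmBorel_torus L v t hd, hd0]
  have hκ0 : (Measure.modularCharacter (⟨(t : ↥(unitaryGroupOfForm (conjLocal L (IsCMField.complexConj L) v) (cmLocalForm L 3 v))), torusU_le_borelU _ _ t.2⟩ : ↥(cmBorelTriple L 3 v).P) : ℝ≥0) ≠ 0 := by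
    rw [hκval]; exact (mul_pos distribHaarChar_pos distribHaarChar_pos).ne'
  have hmc : ∀ u : ↥(cmBorelTriple L 3 v).N,
      (((∏ w' : PlacesOver L v, normAbs (w'.1.adicCompletion L) (((((((HeisRing.torusConj (conjLocal L (IsCMField.complexConj L) v) t u : ↥(cmBorelTriple L 3 v).N) : ↥(unitaryGroupOfForm (conjLocal L (IsCMField.complexConj L) v) (cmLocalForm L 3 v)))) : GL (Fin 3) (LocalRing L v)) : Matrix (Fin 3) (Fin 3) (LocalRing L v)) 0 2) w')) : ℝ≥0) : ℝ) = (a * a)⁻¹ * (((∏ w' : PlacesOver L v, normAbs (w'.1.adicCompletion L) ((((((u : ↥(unitaryGroupOfForm (conjLocal L (IsCMField.complexConj L) v) (cmLocalForm L 3 v)))) : GL (Fin 3) (LocalRing L v)) : Matrix (Fin 3) (Fin 3) (LocalRing L v)) 0 2) w')) : ℝ≥0) : ℝ) := by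
    intro u
    rw [K2E3IntertwiningIntegralMajorant.height_torusConj L v t hd u, hd0, NNReal.coe_mul, NNReal.coe_mul, NNReal.coe_inv, ha, mul_inv]
    rfl
  have hQ : 0 < (a * a)⁻¹ := inv_pos.2 hA
  have hQ1 : 1 < (a * a)⁻¹ := (one_lt_inv₀ hA).2 hA1
  have hκQ : 1 < ((Measure.modularCharacter (⟨(t : ↥(unitaryGroupOfForm (conjLocal L (IsCMField.complexConj L) v) (cmLocalForm L 3 v))), torusU_le_borelU _ _ t.2⟩ : ↥(cmBorelTriple L 3 v).P) : ℝ≥0) : ℝ) * ((a * a)⁻¹) ^ (s + 1) := by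
    rw [hκval, NNReal.coe_mul, ← ha, Real.rpow_add hQ, Real.rpow_one, mul_left_comm, mul_inv_cancel₀ hA.ne', mul_one]
    exact Real.one_lt_rpow hQ1 hs
  have htail := K2E3IntertwiningIntegralShellBound.integrableOn_rpow_neg_of_scaling μ hm hcj hκ hQ hmc hκ0 hQ1 (one_half_pos : (0 : ℝ) < 1 / 2)
    (K2E3IntertwiningIntegralMajorant.measure_normBall_lt_top L v hns μ (1 / 2)).ne (add_pos hs one_pos) hκQ
  -- on `S_ge` the weight has norm `m^{-(s+1)}`
  have hbound : ∀ u : ↥(cmBorelTriple L 3 v).N, 1 ≤ (((∏ w' : PlacesOver L v, normAbs (w'.1.adicCompletion L) ((((((u : ↥(unitaryGroupOfForm (conjLocal L (IsCMField.complexConj L) v) (cmLocalForm L 3 v)))) : GL (Fin 3) (LocalRing L v)) : Matrix (Fin 3) (Fin 3) (LocalRing L v)) 0 2) w')) : ℝ≥0) : ℝ) →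
      ‖(fun n : ↥(cmBorelTriple L 3 v).N =>
        if h : IsUnit ((((n : ↥(unitaryGroupOfForm (conjLocal L (IsCMField.complexConj L) v) (cmLocalForm L 3 v))) : GL (Fin 3) (LocalRing L v)) : Matrix (Fin 3) (Fin 3) (LocalRing L v)) 0 2) then
          ((((χ₁ (Units.map ((conjLocal L (IsCMField.complexConj L) v) : LocalRing L v →* LocalRing L v) h.unit))⁻¹ : ℂˣ) : ℂ) *
            ((((unitModulusChar (LocalRing L v) h.unit)⁻¹ : ℝ≥0) : ℝ) : ℂ))
        else 0) u‖ = (((∏ w' : PlacesOver L v, normAbs (w'.1.adicCompletion L) ((((((u : ↥(unitaryGroupOfForm (conjLocal L (IsCMField.complexConj L) v) (cmLocalForm L 3 v)))) : GL (Fin 3) (LocalRing L v)) : Matrix (Fin 3) (Fin 3) (LocalRing L v)) 0 2) w')) : ℝ≥0) : ℝ) ^ (-(s + 1)) := by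
    intro u hu
    have hmpos : (0 : ℝ) < (((∏ w' : PlacesOver L v, normAbs (w'.1.adicCompletion L) ((((((u : ↥(unitaryGroupOfForm (conjLocal L (IsCMField.complexConj L) v) (cmLocalForm L 3 v)))) : GL (Fin 3) (LocalRing L v)) : Matrix (Fin 3) (Fin 3) (LocalRing L v)) 0 2) w')) : ℝ≥0) : ℝ) := lt_of_lt_of_le one_pos hu
    have hb0 : ((((u : ↥(unitaryGroupOfForm (conjLocal L (IsCMField.complexConj L) v) (cmLocalForm L 3 v))) : GL (Fin 3) (LocalRing L v)) : Matrix (Fin 3) (Fin 3) (LocalRing L v)) 0 2) ≠ 0 := by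
      intro h0
      rw [(F0P3cStCharTSLocalRingNormDictionary.prod_normAbs_eq_zero_iff L v w hw _).2 h0, NNReal.coe_zero] at hmpos
      exact lt_irrefl _ hmpos
    have hb : IsUnit ((((u : ↥(unitaryGroupOfForm (conjLocal L (IsCMField.complexConj L) v) (cmLocalForm L 3 v))) : GL (Fin 3) (LocalRing L v)) : Matrix (Fin 3) (Fin 3) (LocalRing L v)) 0 2) := (F0P3cStCharTSLocalRingNormDictionary.isUnit_iff_ne_zero_localRing L v w hw _).2 hb0
    have hnorm : unitModulusChar (LocalRing L v) hb.unit = (∏ w' : PlacesOver L v, normAbs (w'.1.adicCompletion L) (((((u : ↥(unitaryGroupOfForm (conjLocal L (IsCMField.complexConj L) v) (cmLocalForm L 3 v))) : GL (Fin 3) (LocalRing L v)) : Matrix (Fin 3) (Fin 3) (LocalRing L v)) 0 2) w')) := by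
      rw [unitModulusChar_localRing_eq_prod, hb.unit_spec]
    have hX : (0 : ℝ) < ((unitModulusChar (LocalRing L v) hb.unit : ℝ≥0) : ℝ) := by rw [hnorm]; exact hmpos
    show ‖(if h : IsUnit ((((u : ↥(unitaryGroupOfForm (conjLocal L (IsCMField.complexConj L) v) (cmLocalForm L 3 v))) : GL (Fin 3) (LocalRing L v)) : Matrix (Fin 3) (Fin 3) (LocalRing L v)) 0 2) then
          ((((χ₁ (Units.map ((conjLocal L (IsCMField.complexConj L) v) : LocalRing L v →* LocalRing L v) h.unit))⁻¹ : ℂˣ) : ℂ) *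
            ((((unitModulusChar (LocalRing L v) h.unit)⁻¹ : ℝ≥0) : ℝ) : ℂ))
        else 0)‖ = _
    rw [dif_pos hb, norm_mul]
    have h1 : ‖((((χ₁ (Units.map ((conjLocal L (IsCMField.complexConj L) v) : LocalRing L v →* LocalRing L v) hb.unit))⁻¹ : ℂˣ) : ℂ))‖ = (((unitModulusChar (LocalRing L v) hb.unit : ℝ≥0) : ℝ) ^ s)⁻¹ := by
      rw [Units.val_inv_eq_inv_val, norm_inv, hχ]
      unfold unitModulusChar
      rw [HeisRing.distribHaarChar_map_eq (conjLocal L (IsCMField.complexConj L) v) (conjLocal_conjLocal_cm L v)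
        (continuous_conjLocal L (IsCMField.complexConj L) v)]
    have h3 : ‖((((((unitModulusChar (LocalRing L v) hb.unit)⁻¹ : ℝ≥0) : ℝ)) : ℂ))‖ = (((unitModulusChar (LocalRing L v) hb.unit : ℝ≥0) : ℝ))⁻¹ := by
      rw [Complex.norm_real, NNReal.coe_inv, Real.norm_of_nonneg (inv_nonneg.2 hX.le)]
    rw [h1, h3, ← hnorm, ← Real.rpow_neg hX.le, ← Real.rpow_neg_one, ← Real.rpow_add hX, neg_add]
  -- conclude by domination on `S_ge ⊆ {1/2 < m}`
  have hsub : {u : ↥(cmBorelTriple L 3 v).N | 1 ≤ (((∏ w' : PlacesOver L v, normAbs (w'.1.adicCompletion L) ((((((u : ↥(unitaryGroupOfForm (conjLocal L (IsCMField.complexConj L) v) (cmLocalForm L 3 v)))) : GL (Fin 3) (LocalRing L v)) : Matrix (Fin 3) (Fin 3) (LocalRing L v)) 0 2) w')) : ℝ≥0) : ℝ)} ⊆ {u : ↥(cmBorelTriple L 3 v).N | (1 / 2 : ℝ) < (((∏ w' : PlacesOver L v, normAbs (w'.1.adicCompletion L) ((((((u : ↥(unitaryGroupOfForm (conjLocal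 L (IsCMField.complexConj L) v) (cmLocalForm L 3 v)))) : GL (Fin 3) (LocalRing L v)) : Matrix (Fin 3) (Fin 3) (LocalRing L v)) 0 2) w')) : ℝ≥0) : ℝ)} :=
    fun u hu => by rw [Set.mem_setOf_eq] at hu ⊢; linarith
  refine Integrable.mono' (htail.mono_set hsub) hF.aestronglyMeasurable ?_
  filter_upwards [ae_restrict_mem (measurableSet_le measurable_const hm)] with u hu
  exact (hbound u hu).le

end Summit.HodgeConjecture.HodgeConjecture.Cruxes.H413.K2E3BranchBShellScalingFromWeightSeries

end
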